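import Mathlib
import Summits.CriticalPhenomena.CardyFormulaZ2.Theorems.CardyMagicRigidityNestingRigidityBigLoopsExpMomentMeet
import Summits.CriticalPhenomena.CardyFormulaZ2.Theorems.CardyMagicRigidityMagicFormulaTStubUVSplit
import Literature.Probability.Percolation.SiteNestingWeightIntegrable
import Literature.Probability.Percolation.SiteNestingWeightBound
import HarnessLib

/-!
# A priori moment bounds for line `Sketch` v7 of crux `MagicFormulaT`
# (stubs `apriori_sqMoment`, `apriori_countTight`)

Crux `Summit.CriticalPhenomena.CardyFormulaZ2.Theses.CardyMagicRigidity.MagicFormulaT`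
(stmt-CriticalPhenomena-4836), line `Sketch`, registered skeleton v7 (EXISTENCE ∧ IDENTIFICATION of the
scaling limit of the site-`𝕋` twisted nesting transform), skeleton stub `stub_aprioriBounds`, registered
sub-goals (i) `apriori_sqMoment` and (ii) `apriori_countTight`:

* (i) **uniform-in-mesh second moments of the truncated weights**
  `A^{≥η'}_f(siteLoopConfig δ ω) = ∏_{u, diam u ≥ η'} 2cos(θ_u + π/3)`: for every admissible density `f`
  and `η > 0` there are `B, δ₀ > 0` with `E_{1/2}[(A^{≥η'}_f)²] ≤ B` for all `0 < δ ≤ δ₀`, `η' ≥ η`;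
* (ii) **tightness of the number of loops of diameter `≥ η` meeting `B̄(0, R)`**, uniformly in small
  meshes.

Proof.  Both are read off the keystone K6 of crux 4835 for the loops MEETING a window
(`expMoment_ncard_bigLoops_meeting_le_tEns`, …`NestingRigidityBigLoopsExpMomentMeet`): for `0 < η ≤ R'`
there are `C, c₀ > 0` with `E[exp(s · N_{R',η})] ≤ C` for all meshes `0 < δ`, `c₀ δ ≤ η`, where
`N_{R',η} = #{u : u meets B̄(0, R'), diam u ≥ η}`.  We take `R' = max R η` and `δ₀ = η / c₀`.
(i) The top bound of the UV split (`stub_uvSplit`, third conjunct, at `E = tEns`) gives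
`|A^{≥η'}_f| ≤ 2^{N_{R,η'}}`, and `N_{R,η'} ≤ N_{R',η}` (larger window, lower threshold; all these sets
are finite at a fixed mesh, `ncard_loops_siteLoopConfig_meeting_le`), so
`(A^{≥η'}_f)² ≤ 4^{N_{R',η}} = exp(log 4 · N_{R',η})`, which is integrable with integral `≤ C` (K6 at
`s = log 4`); integrability of the square follows by domination (it is measurable,
`measurable_truncNestingWeight_siteLoopConfig`).
(ii) At a fixed mesh the set is finite, so the bad event is `{N₀ < N_{R,η}} ⊆ {exp(N₀+1) ≤ exp N_{R',η}}`,
and Markov (`mul_meas_ge_le_integral_of_nonneg`) with K6 at `s = 1` bounds its probability by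
`C e^{−(N₀+1)} ≤ κ` for `N₀ = ⌈C/κ⌉₊` (`x + 1 ≤ eˣ`).

No named facts are used; everything is proved tree / Mathlib material.
-/

noncomputable section

namespace Summit.CriticalPhenomena.CardyFormulaZ2.Cruxes.MagicFormulaT.LineSketch

open MeasureTheory Filter Set
open scoped Real Topology BigOperators ENNReal
open Literature.Probability.RandomPlanarGeometry Literature.Probability.Percolation
  Literature.Probability.LatticeModels
open Summit.CriticalPhenomena.CardyFormulaZ2.Cruxes.NestingRigidity.RingCloudTomography
open Summit.CriticalPhenomena.CardyFormulaZ2.Cruxes.NestingRigidity.PositiveConeWeightDoubling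

/-! ## The count of big loops meeting a window: finiteness and monotonicity at a fixed mesh -/

/-- At a fixed mesh `δ > 0` the loops of `siteLoopConfig δ ω` meeting `B̄(0, R)` with diameter `≥ η`
form a finite set. -/
theorem apm_finite_meeting {δ : ℝ} (hδ : 0 < δ) (R η : ℝ) (ω : SiteConfig (Site 2)) :
    {u ∈ (siteLoopConfig δ ω).loops | (u.range ∩ Metric.closedBall (0 : ℂ) R).Nonempty ∧
      η ≤ Metric.diam u.range}.Finite :=
  (ncard_loops_siteLoopConfig_meeting_le hδ R ω).1.subset fun _ hu ↦ ⟨hu.1, hu.2.1⟩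

/-- The count is monotone: enlarging the window and lowering the threshold only adds loops. -/
theorem apm_ncard_meeting_mono {δ : ℝ} (hδ : 0 < δ) {R R' η η' : ℝ} (hR : R ≤ R') (hη : η ≤ η')
    (ω : SiteConfig (Site 2)) :
    {u ∈ (siteLoopConfig δ ω).loops | (u.range ∩ Metric.closedBall (0 : ℂ) R).Nonempty ∧
        η' ≤ Metric.diam u.range}.ncard ≤
      {u ∈ (siteLoopConfig δ ω).loops | (u.range ∩ Metric.closedBall (0 : ℂ) R').Nonempty ∧
        η ≤ Metric.diam u.range}.ncard := by
  refine Set.ncard_le_ncard ?_ (apm_finite_meeting hδ R' η ω)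
  rintro u ⟨hu, ⟨z, hz, hzR⟩, hd⟩
  exact ⟨hu, ⟨z, hz, Metric.closedBall_subset_closedBall hR hzR⟩, hη.trans hd⟩

/-- `exp (log 4 · n) = 4 ^ n`. -/
theorem apm_exp_log_four_mul (n : ℕ) : Real.exp (Real.log 4 * n) = (4 : ℝ) ^ n := by
  rw [mul_comm, Real.exp_nat_mul, Real.exp_log (by norm_num)]

/-! ## The registered sub-goals -/

/-- **Sub-goal (i) of `stub_aprioriBounds`: uniform-in-mesh second moments of the truncated nesting
weights of the site-`𝕋` loop ensemble.**  For an admissible density `f` and `η > 0` there are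
`B, δ₀ > 0` such that for all `0 < δ ≤ δ₀` and `η' ≥ η`, `(A^{≥η'}_f(siteLoopConfig δ ·))²` is
integrable under `P_{1/2}` with integral `≤ B`: `(A^{≥η'}_f)² ≤ 4^{N_{max R η, η}}` and K6
(`expMoment_ncard_bigLoops_meeting_le_tEns` at `s = log 4`). -/
theorem apriori_sqMoment : ∀ (f : ℂ → ℝ) (R C : ℝ), Measurable f → (∀ z, |f z| ≤ C) → (∀ z, R < ‖z‖ → f z = 0) → ∫ z, f z = 0 → ∀ η : ℝ, 0 < η → ∃ B δ₀ : ℝ, 0 < B ∧ 0 < δ₀ ∧ ∀ δ η' : ℝ, 0 < δ → δ ≤ δ₀ → η ≤ η' → Integrable (fun ω ↦ (siteLoopConfig δ ω).truncNestingWeight f η' ^ 2) (triSitePercolation half) ∧ ∫ ω, (siteLoopConfig δ ω).truncNestingWeight f η' ^ 2 ∂(triSitePercolation half) ≤ B := by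
  intro f R C hf hC hR h0 η hη
  obtain ⟨K, c₀, hK, hc₀, hK6⟩ :=
    expMoment_ncard_bigLoops_meeting_le_tEns (Real.log 4) (max R η) η hη (le_max_right R η)
  refine ⟨K, η / c₀, hK, div_pos hη hc₀, fun δ η' hδ hδ₀ hηη' ↦ ?_⟩
  have hc₀δ : c₀ * δ ≤ η :=
    calc c₀ * δ ≤ c₀ * (η / c₀) := mul_le_mul_of_nonneg_left hδ₀ hc₀.le
      _ = η := mul_div_cancel₀ η hc₀.ne'
  obtain ⟨hint, hle⟩ := hK6 δ hδ hc₀δ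
  -- K6 speaks about `tEns.X δ = siteLoopConfig δ` and `tEns.P = triSitePercolation half` (`rfl`)
  change Integrable (fun ω ↦ Real.exp (Real.log 4 * ({u ∈ (siteLoopConfig δ ω).loops |
      (u.range ∩ Metric.closedBall (0 : ℂ) (max R η)).Nonempty ∧
        η ≤ Metric.diam u.range}.ncard : ℝ))) (triSitePercolation half) at hint
  change ∫ ω, Real.exp (Real.log 4 * ({u ∈ (siteLoopConfig δ ω).loops |
      (u.range ∩ Metric.closedBall (0 : ℂ) (max R η)).Nonempty ∧
        η ≤ Metric.diam u.range}.ncard : ℝ)) ∂(triSitePercolation half) ≤ K at hle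
  -- pointwise domination `(A^{≥η'})² ≤ 4^{N_{R,η'}} ≤ 4^{N_{R∨η,η}} = exp (log 4 · N_{R∨η,η})`
  have hdom : ∀ ω, (siteLoopConfig δ ω).truncNestingWeight f η' ^ 2 ≤
      Real.exp (Real.log 4 * ({u ∈ (siteLoopConfig δ ω).loops |
        (u.range ∩ Metric.closedBall (0 : ℂ) (max R η)).Nonempty ∧
          η ≤ Metric.diam u.range}.ncard : ℝ)) := by
    intro ω
    have htop := (stub_uvSplit tEns tEns_mem f R C hf hC hR h0 δ η η' hδ hη hηη' ω).2.2
    change |(siteLoopConfig δ ω).truncNestingWeight f η'| ≤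
      (2 : ℝ) ^ {u ∈ (siteLoopConfig δ ω).loops |
        (u.range ∩ Metric.closedBall (0 : ℂ) R).Nonempty ∧ η' ≤ Metric.diam u.range}.ncard at htop
    rw [apm_exp_log_four_mul, ← sq_abs]
    calc |(siteLoopConfig δ ω).truncNestingWeight f η'| ^ 2
        ≤ ((2 : ℝ) ^ {u ∈ (siteLoopConfig δ ω).loops |
            (u.range ∩ Metric.closedBall (0 : ℂ) R).Nonempty ∧ η' ≤ Metric.diam u.range}.ncard) ^ 2 :=
          pow_le_pow_left₀ (abs_nonneg _) htop 2
      _ = (4 : ℝ) ^ {u ∈ (siteLoopConfig δ ω).loops |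
            (u.range ∩ Metric.closedBall (0 : ℂ) R).Nonempty ∧ η' ≤ Metric.diam u.range}.ncard := by
          rw [← pow_mul', pow_mul]
          norm_num
      _ ≤ (4 : ℝ) ^ {u ∈ (siteLoopConfig δ ω).loops |
            (u.range ∩ Metric.closedBall (0 : ℂ) (max R η)).Nonempty ∧
              η ≤ Metric.diam u.range}.ncard :=
          pow_le_pow_right₀ (by norm_num) (apm_ncard_meeting_mono hδ (le_max_left R η) hηη' ω)
  have hmeas : Measurable fun ω : SiteConfig (Site 2) ↦
      (siteLoopConfig δ ω).truncNestingWeight f η' ^ 2 :=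
    (measurable_truncNestingWeight_siteLoopConfig f η' δ).pow_const 2
  have hintA : Integrable (fun ω ↦ (siteLoopConfig δ ω).truncNestingWeight f η' ^ 2)
      (triSitePercolation half) :=
    hint.mono' hmeas.aestronglyMeasurable (Eventually.of_forall fun ω ↦ by
      rw [Real.norm_eq_abs, abs_of_nonneg (sq_nonneg _)]
      exact hdom ω)
  exact ⟨hintA, (integral_mono hintA hint hdom).trans hle⟩

/-- **Sub-goal (ii) of `stub_aprioriBounds`: tightness of the number of loops of diameter `≥ η`
meeting `B̄(0, R)`, uniformly in small meshes.**  For `η, κ > 0` there are `N₀` and `δ₀ > 0` such that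
for all `0 < δ ≤ δ₀`, outside an event of `P_{1/2}`-probability `≤ κ` the loops of `siteLoopConfig δ ω`
of diameter `≥ η` meeting `B̄(0, R)` form a finite set of at most `N₀` elements: Markov on
`exp N_{max R η, η}` (K6 at `s = 1`), `N₀ = ⌈C/κ⌉₊`. -/
theorem apriori_countTight : ∀ (R η κ : ℝ), 0 < η → 0 < κ → ∃ N₀ : ℕ, ∃ δ₀ : ℝ, 0 < δ₀ ∧ ∀ δ : ℝ, 0 < δ → δ ≤ δ₀ → (triSitePercolation half) {ω | ¬ ({u ∈ (siteLoopConfig δ ω).loops | (u.range ∩ Metric.closedBall (0 : ℂ) R).Nonempty ∧ η ≤ Metric.diam u.range}.Finite ∧ {u ∈ (siteLoopConfig δ ω).loops | (u.range ∩ Metric.closedBall (0 : ℂ) R).Nonempty ∧ η ≤ Metric.diam u.range}.ncard ≤ N₀)} ≤ ENNReal.ofReal κ := by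
  intro R η κ hη hκ
  obtain ⟨K, c₀, hK, hc₀, hK6⟩ :=
    expMoment_ncard_bigLoops_meeting_le_tEns 1 (max R η) η hη (le_max_right R η)
  refine ⟨⌈K / κ⌉₊, η / c₀, div_pos hη hc₀, fun δ hδ hδ₀ ↦ ?_⟩
  have hc₀δ : c₀ * δ ≤ η :=
    calc c₀ * δ ≤ c₀ * (η / c₀) := mul_le_mul_of_nonneg_left hδ₀ hc₀.le
      _ = η := mul_div_cancel₀ η hc₀.ne'
  obtain ⟨hint, hle⟩ := hK6 δ hδ hc₀δ
  -- the dominating statistic `g = exp N_{R∨η,η}` (K6: integrable, `∫ g ≤ K`)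
  set g : SiteConfig (Site 2) → ℝ := fun ω ↦ Real.exp (1 * ({u ∈ (siteLoopConfig δ ω).loops |
      (u.range ∩ Metric.closedBall (0 : ℂ) (max R η)).Nonempty ∧
        η ≤ Metric.diam u.range}.ncard : ℝ)) with hg
  change Integrable g (triSitePercolation half) at hint
  change ∫ ω, g ω ∂(triSitePercolation half) ≤ K at hle
  set N₀ : ℕ := ⌈K / κ⌉₊ with hN₀
  -- the bad event lies in the Markov superlevel set `{exp (N₀ + 1) ≤ g}`
  have hsub : {ω | ¬ ({u ∈ (siteLoopConfig δ ω).loops |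
      (u.range ∩ Metric.closedBall (0 : ℂ) R).Nonempty ∧ η ≤ Metric.diam u.range}.Finite ∧
        {u ∈ (siteLoopConfig δ ω).loops | (u.range ∩ Metric.closedBall (0 : ℂ) R).Nonempty ∧
          η ≤ Metric.diam u.range}.ncard ≤ N₀)} ⊆
      {ω | Real.exp ((N₀ : ℝ) + 1) ≤ g ω} := by
    intro ω hω
    simp only [Set.mem_setOf_eq, not_and, not_le] at hω
    have hlt := hω (apm_finite_meeting hδ R η ω)
    have hmono := apm_ncard_meeting_mono hδ (le_max_left R η) (le_refl η) ω
    simp only [Set.mem_setOf_eq, hg, one_mul]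
    refine Real.exp_le_exp.2 ?_
    exact_mod_cast Nat.succ_le_of_lt (hlt.trans_le hmono)
  -- Markov
  have hexp : 0 < Real.exp ((N₀ : ℝ) + 1) := Real.exp_pos _
  have hmarkov := mul_meas_ge_le_integral_of_nonneg (μ := triSitePercolation half)
    (Eventually.of_forall fun ω ↦ (Real.exp_pos _).le) hint (Real.exp ((N₀ : ℝ) + 1))
  have hreal : (triSitePercolation half).real {ω | Real.exp ((N₀ : ℝ) + 1) ≤ g ω} ≤ κ := by
    have h1 : (triSitePercolation half).real {ω | Real.exp ((N₀ : ℝ) + 1) ≤ g ω} ≤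
        K / Real.exp ((N₀ : ℝ) + 1) := by
      rw [le_div_iff₀ hexp, mul_comm]
      exact hmarkov.trans hle
    refine h1.trans ?_
    rw [div_le_iff₀ hexp]
    have h2 : K / κ ≤ N₀ := Nat.le_ceil _
    rw [div_le_iff₀ hκ] at h2
    have h3 : (N₀ : ℝ) + 1 + 1 ≤ Real.exp ((N₀ : ℝ) + 1) := Real.add_one_le_exp _
    nlinarith [mul_le_mul_of_nonneg_left h3 hκ.le]
  calc (triSitePercolation half) _
      ≤ (triSitePercolation half) {ω | Real.exp ((N₀ : ℝ) + 1) ≤ g ω} := measure_mono hsub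
    _ = ENNReal.ofReal ((triSitePercolation half).real {ω | Real.exp ((N₀ : ℝ) + 1) ≤ g ω}) :=
        (ofReal_measureReal (measure_ne_top _ _)).symm
    _ ≤ ENNReal.ofReal κ := ENNReal.ofReal_le_ofReal hreal

end Summit.CriticalPhenomena.CardyFormulaZ2.Cruxes.MagicFormulaT.LineSketch

end
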